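import Summits.HodgeConjecture.HodgeConjecture.Theorems.R90S4PrincipalSeriesSimilStable          -- ★ p861782 (this seat): (STAB) `isConstituentOf_comap_cmDatumLocalCongr_cmPrincipalSeries`
import Summits.HodgeConjecture.HodgeConjecture.Theorems.R90S4PrincipalSeriesConstituentAdmissible  -- ★ p861781 (this seat): `isAdmissible_of_isConstituentOf_cmPrincipalSeries`
import HarnessLib

/-!
# R90-TF · S4 «Ch. 13.1–2» — socket S4#B5 `stub_R90_S4_H_lds` CUT TO ITS TWO PRINTED [Keys ∕ Labesse–Langlands] INPUTS (composition)

Cell `hodgecm-mathlib`, crux H413 (`stmt-HodgeConjecture-24833`, lane `--supports … --as helper`), route of record `HCCMUnconditional`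
(no route verbs; count-neutral).  Programme R90-TF (HUMAN RULING «R90-TF SLAB — MAX PUSH»; brief `director/R90-BRIEF.v2.md`
1f40d54518340a35), section S4 = Rogawski Ch. 13.1–2 (base `R90-C131`); seat R90-C131-p05 (g0), dealt BY NAME «p05 → S4#B5
`stub_R90_S4_H_lds` — ROAD KEYS U(2): two constituents swapped by an outer similitude; CENSUS-FIRST» (`R90/S4/DEAL-S4-WAVE1.K2E2-plan-g6.md`).
THEOREMS ONLY (no `def`, no instance, no notation, no named fact, no `sorry`); imports ★ only; file B's definitions (`U2Loc`, `Φ₂Loc`,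
`IsU2SimilConj`, `IsRogPacketU2`, `Cruxes/H413/Lines/R90_S4_HPacketsU2B.lean` :150–:158) are UNFOLDED here (a `Theorems/` file may not
import a `Cruxes/…/Lines` file), so that the conclusions below are the socket's body up to `Iff.rfl`-unfolding — certified at HOME by the
by-import probe `R90/R90-C131-p05/g0/probe_lds_byimport.lean` (imports tree B; `stub_R90_S4_H_lds_of … : ‹type of stub_R90_S4_H_lds›`).

THE SOCKET (B :360, [Rogawski1990, §12.1 p. 171 case 2); §11.1 p. 161]): at a place `v` of `L⁺` NON-SPLIT in `L`, for smooth
`χ₁ ∈ Hom(E_v^×, ℂ^×)` with `χ₁|F_v^× = ω_{E/F}` (★ `IsQuadraticCharExtension`) and smooth `χ₂ ∈ Hom(E¹_v, ℂ^×)`, the constituents of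
`i_{U(Φ₂)}((χ₁, χ₂)) = cmPrincipalSeries L 2 v (torusCharPair … 0 χ₁ χ₂)` form ONE L-packet of `U(Φ₂)(L⁺_v)` — a full orbit of an admissible
class under conjugation by local similitudes `T ∈ GL₂(L ⊗ L⁺_v)`, `ᵗT̄ Φ₂ T = a Φ₂` — with exactly TWO elements.  PRINT, p. 161: «An
L-packet on `G` is, by definition, a `PGL₂(F)`-orbit in `E(G)` … `i_G(χ)` is irreducible except … 2) `χ|F^* = ω_{E/F}`.  In both cases
`JH(i_G(χ))` has two elements … In case 2), `χ` is unitary and `JH(i_G(χ))` is an l.d.s. L-packet» (proofs: [LL] for `SL(2)`, [KyS]).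

THE CUT (this file).  For ANY character `χ` of the diagonal torus of `G = U(Φ₂)(L⁺_v)`:
* (STAB) — ★ PROVED (`Theorems/R90S4PrincipalSeriesSimilStable`): conjugation by every local similitude maps `JH(i_G(χ))` into itself;
* (ADM)  — ★ PROVED (`Theorems/R90S4PrincipalSeriesConstituentAdmissible`): constituents of `i_G(χ)` are admissible;
* (TWO)  — HYPOTHESIS `hTwo`: «`JH(i_G(χ))` has exactly two elements» `π₁ ≠ π₂` [p. 161 case 2); Keys–Shahidi];
* (ORBIT) — HYPOTHESIS `hOrbit`: «`JH(i_G(χ))` is ONE `PGL₂(F)`-orbit»: any two constituents are similitude-conjugate [p. 161, «l.d.s.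
  L-packet»; Labesse–Langlands for `SL(2)`];
then `O := {π₁, π₂}` is the full similitude orbit of the admissible class `π₁` (⊆ by (STAB), ⊇ by (ORBIT)), `O.card = 2`, and the members
of `O` are exactly the constituents of `i_G(χ)` — the socket's body (`lds_of_two_of_orbit`).  `stub_R90_S4_H_lds_of_two_of_orbit` is the
same under the socket's own binders and guards (non-split `v`, `χ = torusCharPair … 0 χ₁ χ₂`, `χ₁, χ₂` smooth, `χ₁|F^× = ω`), with (TWO) and
(ORBIT) quantified under the SAME guards — the two remaining UPSTREAM analytic inputs of S4#B5, recorded by name-shape in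
`R90/R90-C131-p05/g0/CENSUS-lds.md`.  NOT used: the orbit-count bound `|F_v^×/N E_w^×| ≤ 2` (road of S4#B4): the orbit is pinned by
(STAB) + (ORBIT) alone.

HONEST LABEL: HC_CM is proved only modulo the 7 printed citations (2 remaining named inputs: hLiu418 = stmt-HodgeConjecture-24832,
h413 = stmt-HodgeConjecture-24833) until rung 0 closes; this file CLOSES NOTHING by itself — it reduces socket S4#B5 to the two printed
p-adic facts (TWO), (ORBIT) of [Rogawski1990, §11.1 p. 161], which are NOT in the tree.  REL ≠ ★ ≠ BUILT.

## References
* [Rogawski1990] J. D. Rogawski, *Automorphic Representations of Unitary Groups in Three Variables*, Ann. of Math. Stud. 123 (1990), §11.1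
  p. 161 (L-packets on `U(2)`; reducibility cases of `i_G(χ)`; Prop. 11.1.1 (c)), §12.1 pp. 171–172 (case 2): `JH(i_H(χ))` is an l.d.s. L-packet).
* [LabesseLanglands1979] J.-P. Labesse, R. P. Langlands, *L-indistinguishability for SL(2)*, Canad. J. Math. 31 (1979), 726–785.
* [BushnellHenniart2006] C. J. Bushnell, G. Henniart, *The Local Langlands Conjecture for GL(2)*, Grundlehren 335 (2006), §1.1–§2.
-/

set_option autoImplicit false
-- the mandated namespace (brief §3.4) repeats the single-problem summit's segment (`HodgeConjecture.HodgeConjecture`)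
set_option linter.dupNamespace false

noncomputable section

open NumberField IsDedekindDomain
open scoped MatrixGroups
open Literature.NumberTheory.Automorphic Literature.NumberTheory.Automorphic.UnitaryGroup

namespace Summit.HodgeConjecture.HodgeConjecture.R90.S4

/-- **Socket S4#B5 at one place, from (TWO) and (ORBIT).**  Fix a finite place `v` of `L⁺` and a character `χ` of the diagonal torus of
`G = U(Φ₂)(L⁺_v)`; write `i(χ) = cmPrincipalSeries L 2 v χ`.  ASSUME (TWO) `i(χ)` has exactly two constituents `π₁ ≠ π₂`, and (ORBIT) any
two constituents of `i(χ)` are conjugate under a local similitude of `Φ₂` (B's `IsU2SimilConj`, unfolded).  THEN the finset `{π₁, π₂}` is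
the full similitude orbit of the admissible class `π₁` (B's `IsRogPacketU2`, unfolded: ⊇ by (ORBIT), ⊆ because similitudes permute `JH(i(χ))`
— ★ `isConstituentOf_comap_cmDatumLocalCongr_cmPrincipalSeries`; `π₁` admissible by ★ `isAdmissible_of_isConstituentOf_cmPrincipalSeries`),
it has two elements, and its members are exactly the constituents of `i(χ)`. [cite: Rogawski1990, §11.1 p. 161; §12.1 p. 171] -/
theorem lds_of_two_of_orbit (L : Type) [Field L] [NumberField L] [IsCMField L]
    (v : HeightOneSpectrum (𝓞 ↥(maximalRealSubfield L)))
    (χ : ↥(torusU (conjLocal L (IsCMField.complexConj L) v) (cmLocalForm L 2 v)) →* ℂˣ)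
    (hTwo : ∃ π₁ π₂ : IrrClass ((cmDatum L 2 (Matrix.of fun i j : Fin 2 => if i.val + j.val + 1 = 2 then (1 : L) else 0)).Local v),
      π₁ ≠ π₂ ∧ ∀ c, c.IsConstituentOf (cmPrincipalSeries L 2 v χ) ↔ c = π₁ ∨ c = π₂)
    (hOrbit : ∀ c c' : IrrClass ((cmDatum L 2 (Matrix.of fun i j : Fin 2 => if i.val + j.val + 1 = 2 then (1 : L) else 0)).Local v),
      c.IsConstituentOf (cmPrincipalSeries L 2 v χ) → c'.IsConstituentOf (cmPrincipalSeries L 2 v χ) →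
        ∃ (T : GL (Fin 2) (LocalRing L v)) (a : LocalRing L v) (ha : IsUnit a)
          (h : formCongr (conjLocal L (IsCMField.complexConj L) v) T
            ((Matrix.of fun i j : Fin 2 => if i.val + j.val + 1 = 2 then (1 : L) else 0).map (algebraMap L (LocalRing L v))) =
            a • (Matrix.of fun i j : Fin 2 => if i.val + j.val + 1 = 2 then (1 : L) else 0).map (algebraMap L (LocalRing L v))),
          c' = IrrClass.comap (cmDatumLocalCongr L v T ha h) c) :
    ∃ O : Finset (IrrClass ((cmDatum L 2 (Matrix.of fun i j : Fin 2 => if i.val + j.val + 1 = 2 then (1 : L) else 0)).Local v)),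
      (∃ σ : IrrClass ((cmDatum L 2 (Matrix.of fun i j : Fin 2 => if i.val + j.val + 1 = 2 then (1 : L) else 0)).Local v),
        σ.IsAdmissible ∧ ∀ c, c ∈ O ↔
          ∃ (T : GL (Fin 2) (LocalRing L v)) (a : LocalRing L v) (ha : IsUnit a)
            (h : formCongr (conjLocal L (IsCMField.complexConj L) v) T
              ((Matrix.of fun i j : Fin 2 => if i.val + j.val + 1 = 2 then (1 : L) else 0).map (algebraMap L (LocalRing L v))) =
              a • (Matrix.of fun i j : Fin 2 => if i.val + j.val + 1 = 2 then (1 : L) else 0).map (algebraMap L (LocalRing L v))),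
            c = IrrClass.comap (cmDatumLocalCongr L v T ha h) σ) ∧
      O.card = 2 ∧ ∀ c, c ∈ O ↔ c.IsConstituentOf (cmPrincipalSeries L 2 v χ) := by
  classical
  obtain ⟨π₁, π₂, hne, hcons⟩ := hTwo
  have h₁ : π₁.IsConstituentOf (cmPrincipalSeries L 2 v χ) := (hcons π₁).2 (Or.inl rfl)
  have h₂ : π₂.IsConstituentOf (cmPrincipalSeries L 2 v χ) := (hcons π₂).2 (Or.inr rfl)
  refine ⟨{π₁, π₂}, ⟨π₁, isAdmissible_of_isConstituentOf_cmPrincipalSeries L v 2 χ h₁, fun c => ?_⟩, ?_, fun c => ?_⟩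
  · -- membership ↔ similitude-conjugate to `π₁`
    rw [Finset.mem_insert, Finset.mem_singleton]
    constructor
    · rintro (rfl | rfl)
      · exact hOrbit _ _ h₁ h₁
      · exact hOrbit _ _ h₁ h₂
    · rintro ⟨T, a, ha, h, rfl⟩
      exact (hcons _).1 (isConstituentOf_comap_cmDatumLocalCongr_cmPrincipalSeries L v χ T a ha h h₁)
  · exact Finset.card_pair hne
  · -- keep the principal series out of the goal before rewriting finset membership
    refine Iff.trans ?_ (hcons c).symm
    rw [Finset.mem_insert, Finset.mem_singleton]

/-- **SOCKET S4#B5 `stub_R90_S4_H_lds` FROM ITS TWO PRINTED INPUTS**, under the socket's own binders and guards (non-split `v`; smooth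
`χ₁, χ₂`; `χ₁|F_v^× = ω_{E/F}`), with (TWO) «`JH(i_G((χ₁, χ₂)))` has exactly two elements» and (ORBIT) «`JH(i_G((χ₁, χ₂)))` is one
`PGL₂(F)`-orbit» quantified under the SAME guards; the conclusion is the socket's statement with B's `U2Loc ∕ IsRogPacketU2 ∕ IsU2SimilConj`
unfolded (identity certified by the HOME by-import probe). [cite: Rogawski1990, §11.1 p. 161; §12.1 p. 171] -/
theorem stub_R90_S4_H_lds_of_two_of_orbit
    (hTwo : ∀ (L : Type) [Field L] [NumberField L] [IsCMField L] (v : HeightOneSpectrum (𝓞 ↥(maximalRealSubfield L))),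
      (∀ w : PlacesOver L v, IsCMField.complexConj L • w.1 = w.1) →
      ∀ (χ₁ : (LocalRing L v)ˣ →* ℂˣ) (χ₂ : ↥(normOneUnits (conjLocal L (IsCMField.complexConj L) v)) →* ℂˣ),
        IsOpen ((χ₁.ker : Subgroup (LocalRing L v)ˣ) : Set (LocalRing L v)ˣ) →
        IsOpen ((χ₂.ker : Subgroup ↥(normOneUnits (conjLocal L (IsCMField.complexConj L) v))) :
          Set ↥(normOneUnits (conjLocal L (IsCMField.complexConj L) v))) →
        IsQuadraticCharExtension (conjLocal L (IsCMField.complexConj L) v) χ₁ →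
        ∃ π₁ π₂ : IrrClass ((cmDatum L 2 (Matrix.of fun i j : Fin 2 => if i.val + j.val + 1 = 2 then (1 : L) else 0)).Local v),
          π₁ ≠ π₂ ∧ ∀ c, c.IsConstituentOf (cmPrincipalSeries L 2 v
            (torusCharPair (conjLocal L (IsCMField.complexConj L) v) (cmLocalForm L 2 v) (cmLocalForm_eq_over L 2 v) 0 χ₁ χ₂)) ↔
              c = π₁ ∨ c = π₂)
    (hOrbit : ∀ (L : Type) [Field L] [NumberField L] [IsCMField L] (v : HeightOneSpectrum (𝓞 ↥(maximalRealSubfield L))),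
      (∀ w : PlacesOver L v, IsCMField.complexConj L • w.1 = w.1) →
      ∀ (χ₁ : (LocalRing L v)ˣ →* ℂˣ) (χ₂ : ↥(normOneUnits (conjLocal L (IsCMField.complexConj L) v)) →* ℂˣ),
        IsOpen ((χ₁.ker : Subgroup (LocalRing L v)ˣ) : Set (LocalRing L v)ˣ) →
        IsOpen ((χ₂.ker : Subgroup ↥(normOneUnits (conjLocal L (IsCMField.complexConj L) v))) :
          Set ↥(normOneUnits (conjLocal L (IsCMField.complexConj L) v))) →
        IsQuadraticCharExtension (conjLocal L (IsCMField.complexConj L) v) χ₁ →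
        ∀ c c' : IrrClass ((cmDatum L 2 (Matrix.of fun i j : Fin 2 => if i.val + j.val + 1 = 2 then (1 : L) else 0)).Local v),
          c.IsConstituentOf (cmPrincipalSeries L 2 v
            (torusCharPair (conjLocal L (IsCMField.complexConj L) v) (cmLocalForm L 2 v) (cmLocalForm_eq_over L 2 v) 0 χ₁ χ₂)) →
          c'.IsConstituentOf (cmPrincipalSeries L 2 v
            (torusCharPair (conjLocal L (IsCMField.complexConj L) v) (cmLocalForm L 2 v) (cmLocalForm_eq_over L 2 v) 0 χ₁ χ₂)) →
          ∃ (T : GL (Fin 2) (LocalRing L v)) (a : LocalRing L v) (ha : IsUnit a)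
            (h : formCongr (conjLocal L (IsCMField.complexConj L) v) T
              ((Matrix.of fun i j : Fin 2 => if i.val + j.val + 1 = 2 then (1 : L) else 0).map (algebraMap L (LocalRing L v))) =
              a • (Matrix.of fun i j : Fin 2 => if i.val + j.val + 1 = 2 then (1 : L) else 0).map (algebraMap L (LocalRing L v))),
            c' = IrrClass.comap (cmDatumLocalCongr L v T ha h) c) :
    ∀ (L : Type) [Field L] [NumberField L] [IsCMField L] (v : HeightOneSpectrum (𝓞 ↥(maximalRealSubfield L))),
      (∀ w : PlacesOver L v, IsCMField.complexConj L • w.1 = w.1) →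
      ∀ (χ₁ : (LocalRing L v)ˣ →* ℂˣ) (χ₂ : ↥(normOneUnits (conjLocal L (IsCMField.complexConj L) v)) →* ℂˣ),
        IsOpen ((χ₁.ker : Subgroup (LocalRing L v)ˣ) : Set (LocalRing L v)ˣ) →
        IsOpen ((χ₂.ker : Subgroup ↥(normOneUnits (conjLocal L (IsCMField.complexConj L) v))) :
          Set ↥(normOneUnits (conjLocal L (IsCMField.complexConj L) v))) →
        IsQuadraticCharExtension (conjLocal L (IsCMField.complexConj L) v) χ₁ →
        ∃ O : Finset (IrrClass ((cmDatum L 2 (Matrix.of fun i j : Fin 2 => if i.val + j.val + 1 = 2 then (1 : L) else 0)).Local v)),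
          (∃ σ : IrrClass ((cmDatum L 2 (Matrix.of fun i j : Fin 2 => if i.val + j.val + 1 = 2 then (1 : L) else 0)).Local v),
            σ.IsAdmissible ∧ ∀ c, c ∈ O ↔
              ∃ (T : GL (Fin 2) (LocalRing L v)) (a : LocalRing L v) (ha : IsUnit a)
                (h : formCongr (conjLocal L (IsCMField.complexConj L) v) T
                  ((Matrix.of fun i j : Fin 2 => if i.val + j.val + 1 = 2 then (1 : L) else 0).map (algebraMap L (LocalRing L v))) =
                  a • (Matrix.of fun i j : Fin 2 => if i.val + j.val + 1 = 2 then (1 : L) else 0).map (algebraMap L (LocalRing L v))),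
                c = IrrClass.comap (cmDatumLocalCongr L v T ha h) σ) ∧
          O.card = 2 ∧
          ∀ c : IrrClass ((cmDatum L 2 (Matrix.of fun i j : Fin 2 => if i.val + j.val + 1 = 2 then (1 : L) else 0)).Local v), c ∈ O ↔
            c.IsConstituentOf
              (cmPrincipalSeries L 2 v
                (torusCharPair (conjLocal L (IsCMField.complexConj L) v) (cmLocalForm L 2 v) (cmLocalForm_eq_over L 2 v) 0 χ₁ χ₂)) :=
  fun L _ _ _ v hv χ₁ χ₂ hχ₁ hχ₂ hq =>
    lds_of_two_of_orbit L v _ (hTwo L v hv χ₁ χ₂ hχ₁ hχ₂ hq) (hOrbit L v hv χ₁ χ₂ hχ₁ hχ₂ hq)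

end Summit.HodgeConjecture.HodgeConjecture.R90.S4

end
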